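import Literature.NumberTheory.EllipticCurves.ManinSymbolsWeightK
import Literature.NumberTheory.EllipticCurves.EichlerShimuraPeriodsGamma1
import HarnessLib

/-!
# Weight-`k` Manin symbols of `Γ₁(N)` from the Eichler–Shimura periods, Manin's trick, and the
# rank bound `12 rank_ℤ Λ ≤ (k - 1)[SL(2, ℤ) : Γ₁(N)]` for the period lattice of `S_k(Γ₁(N))`

Continuation of `ManinSymbolsWeightK` (the formal module of weight-`k` Manin symbols of a
finite-index `Γ` and the count `12 dim(M/rel) ≤ (n + 1)[SL(2, ℤ) : Γ]`), applied to the period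
lattice `Λ = periodLatticeK1 n ⊆ S_{n+2}(Γ₁(N))^∨` of `EichlerShimuraPeriodsGamma1` — the lattice
whose rank the tree needs (`heckeStableRealLatticeOfGenerators`,
`EichlerShimuraPeriodsGamma1RealSpanProofs`; `DeligneSerreWeightOneOfEichlerShimuraRank`):

* `pathFnl n γ q : f ↦ c_f(γ)(q) = ∫_∞^{γ∞} f(z)((γq)₁z - (γq)₀)ⁿ dz` for **every** `γ ∈ SL(2, ℤ)`
  (the generators `periodFunctionalK1 n σ q` of `Λ` are its values at `σ ∈ Γ₀(N)`), with
  `periodFn1_mul_of_apply_one_zero` (`c_f(hu)(p) = c_f(h)(up)` for `u₁₀ = 0`; so `λ_{hTᵐ,q} = λ_{h,Tᵐq}`,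
  `λ_{-h,q} = λ_{h,-q}`) and the untwisted cocycle relation over `Γ₁(N)` (`pathFnl_mul_of_mem`);
* the **period Manin symbols** `msymQ n h q = λ_{h,q} - λ_{hS,S⁻¹q} = ∫_{h0}^{h∞} f(z)((hq)₁z - (hq)₀)ⁿ dz`
  (Merel 1994, §1.2), left `Γ₁(N)`-invariant, with the **two-term, three-term and sign relations**
  (`msymQ_two_term`, `msymQ_three_term` — the six paths along the ideal triangle `h∞, h0, h1`
  cancel in pairs by `hUS = h(-T)`, `hU² = hST⁻¹`, `hU²S = -(hU)T` — `msymQ_neg`) and polynomial in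
  `q` (`msymQ_isPolyE`): a `PolySymbol n (Gamma1 N)` (`periodSymbol`);
* **Manin's trick** (`pathFnl_mem_symbolSpan`, continued fractions as a Euclidean induction on
  `k₁₀`): every `λ_{k,q}` is a sum of Manin symbols, hence `Λ ⊆ ℚ`-span of the symbols
  (`periodLatticeK1_subset_symbolSpan`);
* `gamma1_free`: for `N ≥ 4`, no conjugate of `-1, ±S, ±TS, ±(TS)²` lies in `Γ₁(N)` (traces);
* **`twelve_mul_finrank_span_periodLatticeK1_le`**: `12 dim_ℚ ℚΛ ≤ (n + 1)[SL(2, ℤ) : Γ₁(N)]` for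
  `n ≥ 1`, `N ≥ 4`, and the generator form `periodLatticeK1_eq_span_of_le` (`Λ` is the `ℤ`-span of
  `m` functionals whenever `(n + 1)[SL(2, ℤ) : Γ₁(N)] ≤ 12m`).

With `[SL(2, ℤ) : Γ₁(N)] = 2μ₁`, `μ₁ = [SL(2, ℤ) : ±Γ₁(N)]`, this is `rank Λ ≤ (n+1)μ₁/6`, which
exceeds `2 dim S_{n+2}(Γ₁(N)) = (n+1)μ₁/6 - ε_∞` (Shimura (8.2.23); the lower bound
`12 dim S_k ≥ (k-1)μ₁ - 6ε_∞` is `ModularFormsGamma1Dimension.le_twelve_mul_finrank_cuspForm_gamma1`)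
by exactly the number of cusps: the generators `λ_{σ,q}` are not cuspidal symbols (boundary
`q₁ⁿ[σ∞] - ((σq)₁)ⁿ[∞]`), and the missing `ε_∞` is recovered in the sequel by the boundary map and a
Manin–Drinfeld argument for the cusps above `∞`. Everything here is proved; no named facts.

## References

* L. Merel, *Universal Fourier expansions of modular forms*, LNM 1585 (1994), §1.2 Prop. 1 (Manin
  symbols `[P, g] = P|g{g0, g∞}`, their relations, and generation via Manin's trick), §1.3 Prop. 3.
* Ju. I. Manin, *Parabolic points and zeta functions of modular curves*, Izv. Akad. Nauk SSSR 36
  (1972), Thm. 1.6 (continued fractions).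
* G. Shimura, *Introduction to the arithmetic theory of automorphic functions* (1971), §8.2,
  Thm. 8.4, (8.2.23).
-/

noncomputable section

namespace Literature.NumberTheory.EllipticCurves.ModularForms

namespace ManinK

open Module Matrix.SpecialLinearGroup ModularGroup CongruenceSubgroup
open scoped MatrixGroups ModularForm

section Periods

variable {N : ℕ} [NeZero N] (n : ℕ)

/-- The path functional `λ_{γ,q} : f ↦ c_f(γ)(q) = ∫_∞^{γ∞} f(z)((γq)₁ z - (γq)₀)ⁿ dz` for every
`γ ∈ SL(2, ℤ)` (the tree's `periodFunctionalK1` is its restriction to `γ ∈ Γ₀(N)`). [folklore] -/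
def pathFnl (γ : SL(2, ℤ)) (q : Fin 2 → ℤ) : Module.Dual ℂ (CuspForm (Gamma1 N) (n + 2)) where
  toFun f := periodFn1 n f γ (fun i ↦ (q i : ℂ))
  map_add' f g := periodFn1_add f g γ _
  map_smul' c f := periodFn1_smul c f γ _

/-- Unfolding `pathFnl`. [folklore] -/
@[simp] theorem pathFnl_apply (γ : SL(2, ℤ)) (q : Fin 2 → ℤ) (f : CuspForm (Gamma1 N) (n + 2)) :
    pathFnl n γ q f = periodFn1 n f γ (fun i ↦ (q i : ℂ)) := rfl

/-- `periodFunctionalK1` is `pathFnl` on `Γ₀(N)`. [folklore] -/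
theorem periodFunctionalK1_eq_pathFnl (σ : Gamma0 N) (q : Fin 2 → ℤ) :
    periodFunctionalK1 n σ q = pathFnl n (σ : SL(2, ℤ)) q := rfl

/-- `λ_{1,q} = 0`. [folklore] -/
@[simp] theorem pathFnl_one (q : Fin 2 → ℤ) : pathFnl (N := N) n 1 q = 0 := by
  ext f
  simp

/-- **Right multiplication by a matrix fixing `∞`**: `c_f(hu)(p) = c_f(h)(up)` for `u ∈ SL(2, ℤ)`
with `u₁₀ = 0` (i.e. `u = ±Tᵐ`), by the base-point independence of the period cocycle and the
change of variables `eichlerKernel_slash_eq_of_apply_one_zero` (the level-`Γ₁(N)` copy of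
`periodFn_mul_of_apply_one_zero` of `EichlerShimuraPeriodsRankProofs`). [folklore] -/
theorem periodFn1_mul_of_apply_one_zero (f : CuspForm (Gamma1 N) (n + 2)) (h u : SL(2, ℤ))
    (hu : u 1 0 = 0) (p : Fin 2 → ℂ) :
    periodFn1 n f (h * u) p = periodFn1 n f h ((icmat u).mulVec p) := by
  rw [periodFn1_eq f (h * u) p UpperHalfPlane.I, periodFn1_eq f h _ (u • UpperHalfPlane.I), mul_smul,
    icmat_mul, ← Matrix.mulVec_mulVec]
  congr 1
  have hφ : IsCuspFunction N (⇑f ∣[(n + 2 : ℤ)] h) := isCuspFunction_slash_gamma1 f h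
  have hψ : IsCuspFunction N ((⇑f ∣[(n + 2 : ℤ)] h) ∣[(n + 2 : ℤ)] (u : GL (Fin 2) ℝ)) := by
    rw [← ModularForm.SL_slash, ← SlashAction.slash_mul]
    exact isCuspFunction_slash_gamma1 f (h * u)
  have hg10 : (u : GL (Fin 2) ℝ) 1 0 = 0 := by
    simp [hu]
  have := hφ.eichlerKernel_slash_eq_of_apply_one_zero (n := n) (det_coe_pos u) hg10 hψ p
    UpperHalfPlane.I
  rw [cmat_coe, ← ModularForm.SL_slash, ← SlashAction.slash_mul] at this
  rw [this]
  rfl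

/-- `λ_{hu,q} = λ_{h,uq}` for `u₁₀ = 0`. [folklore] -/
theorem pathFnl_mul_of_apply_one_zero (h u : SL(2, ℤ)) (hu : u 1 0 = 0) (q : Fin 2 → ℤ) :
    pathFnl (N := N) n (h * u) q = pathFnl n h (act u q) := by
  ext f
  rw [pathFnl_apply, pathFnl_apply, periodFn1_mul_of_apply_one_zero n f h u hu,
    icmat_mulVec_intCast]
  rfl

/-- `λ_{-h,q} = λ_{h,-q}` (`-h = h(-1)`, `(-1)₁₀ = 0`). [folklore] -/
theorem pathFnl_neg (h : SL(2, ℤ)) (q : Fin 2 → ℤ) : pathFnl (N := N) n (-h) q = pathFnl n h (-q) := by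
  rw [← mul_neg_one, pathFnl_mul_of_apply_one_zero n h (-1) (by simp), act_neg, act_one]

/-- `λ_{hTᵐ,q} = λ_{h,Tᵐq}`. [folklore] -/
theorem pathFnl_mul_T_zpow (h : SL(2, ℤ)) (m : ℤ) (q : Fin 2 → ℤ) :
    pathFnl (N := N) n (h * T ^ m) q = pathFnl n h (act (T ^ m) q) :=
  pathFnl_mul_of_apply_one_zero n h _ (by simp [ModularGroup.coe_T_zpow]) q

/-- **The cocycle relation over `Γ₁(N)`**: `λ_{γg,q} = λ_{g,q} + λ_{γ,gq}` for `γ ∈ Γ₁(N)` (no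
diamond twist: `⟨γ⟩ = 1`). [folklore] -/
theorem pathFnl_mul_of_mem {γ : SL(2, ℤ)} (hγ : γ ∈ Gamma1 N) (g : SL(2, ℤ)) (q : Fin 2 → ℤ) :
    pathFnl (N := N) n (γ * g) q = pathFnl n g q + pathFnl n γ (act g q) := by
  have hγ0 : γ ∈ Gamma0 N := Gamma1_in_Gamma0 N hγ
  have h1 : Gamma0Map N ⟨γ, hγ0⟩ = 1 := ((Gamma1_mem N γ).mp hγ).2.1
  ext f
  rw [LinearMap.add_apply, pathFnl_apply, pathFnl_apply, pathFnl_apply]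
  have := periodFn1_mul f ⟨γ, hγ0⟩ g (fun i ↦ (q i : ℂ))
  rw [h1, diamondOp_one_eq_id, LinearMap.id_apply, icmat_mulVec_intCast] at this
  exact this

/-- **The period Manin symbol** `[h, q] = λ_{h,q} - λ_{hS,S⁻¹q} = ∫_{h0}^{h∞} f(z)((hq)₁ z - (hq)₀)ⁿ dz`
of `h ∈ SL(2, ℤ)`, `q ∈ ℤ²` (Merel 1994, §1.2: `[P, g] = P|g{g0, g∞}`). [cite: Merel1994, §1.2 Prop. 1] -/
def msymQ (h : SL(2, ℤ)) (q : Fin 2 → ℤ) : Module.Dual ℂ (CuspForm (Gamma1 N) (n + 2)) :=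
  pathFnl n h q - pathFnl n (h * S) (act S⁻¹ q)

/-- Unfolding `msymQ`. [folklore] -/
theorem msymQ_def (h : SL(2, ℤ)) (q : Fin 2 → ℤ) :
    msymQ (N := N) n h q = pathFnl n h q - pathFnl n (h * S) (act S⁻¹ q) := rfl

/-- **Left `Γ₁(N)`-invariance** of the Manin symbols. [cite: Merel1994, §1.2 Prop. 1] -/
theorem msymQ_mul_of_mem {γ : SL(2, ℤ)} (hγ : γ ∈ Gamma1 N) (h : SL(2, ℤ)) (q : Fin 2 → ℤ) :
    msymQ (N := N) n (γ * h) q = msymQ n h q := by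
  rw [msymQ_def, msymQ_def, mul_assoc, pathFnl_mul_of_mem n hγ, pathFnl_mul_of_mem n hγ, act_mul,
    act_act_inv]
  abel

omit [NeZero N] in
/-- `S⁻¹S⁻¹q = -q`. [folklore] -/
theorem act_S_inv_act_S_inv (q : Fin 2 → ℤ) : act S⁻¹ (act S⁻¹ q) = -q := by
  rw [← act_mul, ← mul_inv_rev, S_mul_S_eq_neg_one, inv_neg, inv_one, act_neg, act_one]

/-- **The two-term relation** `[h, q] + [hS, S⁻¹q] = 0` (`hS² = -h`). [cite: Merel1994, §1.2 Prop. 1] -/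
theorem msymQ_two_term (h : SL(2, ℤ)) (q : Fin 2 → ℤ) :
    msymQ (N := N) n h q + msymQ n (h * S) (act S⁻¹ q) = 0 := by
  rw [msymQ_def, msymQ_def, act_S_inv_act_S_inv, mul_assoc, S_mul_S_eq_neg_one, mul_neg_one,
    pathFnl_neg, neg_neg]
  abel

omit [NeZero N] in
/-- `act` of `S`, `S⁻¹`, `T`, `T⁻¹` in coordinates. [folklore] -/
theorem act_S (q : Fin 2 → ℤ) : act S q = ![-q 1, q 0] := by
  funext i; fin_cases i <;> simp [act_apply_zero, act_apply_one, ModularGroup.coe_S]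

omit [NeZero N] in
/-- `S⁻¹q = (q₁, -q₀)`. [folklore] -/
theorem act_S_inv (q : Fin 2 → ℤ) : act S⁻¹ q = ![q 1, -q 0] := by
  rw [ModularGroup.S_inv, act_neg, act_S]
  funext i; fin_cases i <;> simp

omit [NeZero N] in
/-- `Tq = (q₀ + q₁, q₁)`. [folklore] -/
theorem act_T (q : Fin 2 → ℤ) : act T q = ![q 0 + q 1, q 1] := by
  funext i; fin_cases i <;> simp [act_apply_zero, act_apply_one, ModularGroup.coe_T]

omit [NeZero N] in
/-- `T⁻¹q = (q₀ - q₁, q₁)`. [folklore] -/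
theorem act_T_inv (q : Fin 2 → ℤ) : act T⁻¹ q = ![q 0 - q 1, q 1] := by
  funext i
  fin_cases i <;>
    simp [act_apply_zero, act_apply_one, Matrix.SpecialLinearGroup.coe_inv, ModularGroup.coe_T,
      Matrix.adjugate_fin_two, sub_eq_add_neg]

omit [NeZero N] in
/-- `(TS)⁻¹q = S⁻¹T⁻¹q = (q₁, q₁ - q₀)`. [folklore] -/
theorem act_TS_inv (q : Fin 2 → ℤ) : act (T * S)⁻¹ q = ![q 1, q 1 - q 0] := by
  rw [mul_inv_rev, act_mul, act_T_inv, act_S_inv]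
  funext i
  fin_cases i
  · simp
  · simp [sub_eq_add_neg]

/-- **The three-term relation** `[h, q] + [hU, U⁻¹q] + [hU², U⁻²q] = 0`, `U = TS`: the six path
functionals cancel in pairs along the triangle `h∞, h0, h1` (`hUS = h(-T)`, `hU² = hST⁻¹`,
`hU²S = -(hU)T`, and `pathFnl_mul_T_zpow`, `pathFnl_neg`). [cite: Merel1994, §1.2 Prop. 1] -/
theorem msymQ_three_term (h : SL(2, ℤ)) (q : Fin 2 → ℤ) :
    msymQ (N := N) n h q + msymQ n (h * (T * S)) (act (T * S)⁻¹ q) +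
      msymQ n (h * (T * S) * (T * S)) (act (T * S)⁻¹ (act (T * S)⁻¹ q)) = 0 := by
  have TS_mul_S' : T * S * S = -T := by decide
  have TS_mul_TS' : T * S * (T * S) = S * T⁻¹ := by decide
  have TS_mul_TS_mul_S : T * S * (T * S) * S = -(T * S * T) := by decide
  -- (1) `λ_{hUS, S⁻¹U⁻¹q} = λ_{h,q}`
  have e1 : pathFnl (N := N) n (h * (T * S) * S) (act S⁻¹ (act (T * S)⁻¹ q)) = pathFnl n h q := by
    rw [mul_assoc h, TS_mul_S', mul_neg, pathFnl_neg, ← zpow_one T, pathFnl_mul_T_zpow, zpow_one]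
    congr 1
    simp only [act_S_inv, act_TS_inv, act_T]
    funext i; fin_cases i <;> simp
  -- (2) `λ_{hU², U⁻²q} = λ_{hS, S⁻¹q}`
  have e2 : pathFnl (N := N) n (h * (T * S) * (T * S)) (act (T * S)⁻¹ (act (T * S)⁻¹ q)) =
      pathFnl n (h * S) (act S⁻¹ q) := by
    rw [mul_assoc h, TS_mul_TS', ← mul_assoc, ← zpow_neg_one, pathFnl_mul_T_zpow, zpow_neg_one]
    congr 1
    simp only [act_TS_inv, act_T_inv, act_S_inv]
    funext i; fin_cases i <;> simp
  -- (3) `λ_{hU²S, S⁻¹U⁻²q} = λ_{hU, U⁻¹q}`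
  have e3 : pathFnl (N := N) n (h * (T * S) * (T * S) * S) (act S⁻¹ (act (T * S)⁻¹ (act (T * S)⁻¹ q))) =
      pathFnl n (h * (T * S)) (act (T * S)⁻¹ q) := by
    rw [mul_assoc h, mul_assoc h, TS_mul_TS_mul_S, mul_neg, pathFnl_neg, ← mul_assoc, ← zpow_one T,
      pathFnl_mul_T_zpow, zpow_one]
    congr 1
    simp only [act_S_inv, act_TS_inv, act_T]
    funext i; fin_cases i <;> simp
  rw [msymQ_def, msymQ_def, msymQ_def, e1, e2, e3]
  abel

/-- **The sign relation** `[-h, -q] = [h, q]`. [cite: Merel1994, §1.2 Prop. 1] -/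
theorem msymQ_neg (h : SL(2, ℤ)) (q : Fin 2 → ℤ) : msymQ (N := N) n (-h) (-q) = msymQ n h q := by
  rw [msymQ_def, msymQ_def, neg_mul, pathFnl_neg, pathFnl_neg, neg_neg]
  congr 2
  rw [act_S_inv, act_S_inv]
  funext i; fin_cases i <;> simp

/-- **The period functional as an integral combination of moments**:
`λ_{γ,q} = ∑ⱼ q₁ʲ(-q₀)ⁿ⁻ʲ M_{γ,1,j} - ∑ⱼ (γq)₁ʲ(-(γq)₀)ⁿ⁻ʲ M_{1,γ,j}` (cf.
`dualMap_diamondOp_periodFunctionalK1_eq_sum`). [folklore] -/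
theorem pathFnl_eq_sum (γ : SL(2, ℤ)) (q : Fin 2 → ℤ) :
    pathFnl (N := N) n γ q =
      ∑ j ∈ Finset.range (n + 1), (q 1 ^ j * (-(q 0)) ^ (n - j)) • momentFunctional1 n γ 1 j -
      ∑ j ∈ Finset.range (n + 1), ((act γ q 1) ^ j * (-(act γ q 0)) ^ (n - j)) •
          momentFunctional1 n 1 γ j := by
  ext f
  simp only [pathFnl_apply, periodFn1, eichlerKernel, LinearMap.sub_apply, LinearMap.coe_sum,
    Finset.sum_apply, LinearMap.smul_apply, icmat_mulVec_intCast, act]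
  congr 1
  · refine Finset.sum_congr rfl fun j _ ↦ ?_
    simp only [momentFunctional1, LinearMap.coe_mk, AddHom.coe_mk, zsmul_eq_mul, one_smul]
    push_cast
    ring
  · refine Finset.sum_congr rfl fun j _ ↦ ?_
    simp only [momentFunctional1, LinearMap.coe_mk, AddHom.coe_mk, zsmul_eq_mul, SlashAction.slash_one]
    push_cast
    ring

end Periods

/-! ### The period symbol system of `Γ₁(N)` -/

section Symbol

variable (N : ℕ) [NeZero N] (n : ℕ)

/-- The period Manin symbol of a coset: `[gΓ₁(N), q] := [g⁻¹, q]` (well defined by the left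
`Γ₁(N)`-invariance `msymQ_mul_of_mem`). [folklore] -/
def cosetSym (x : Coset (Gamma1 N)) (q : Fin 2 → ℤ) : Module.Dual ℂ (CuspForm (Gamma1 N) (n + 2)) :=
  Quotient.liftOn' x (fun g ↦ msymQ n g⁻¹ q) fun a b hab ↦ by
    rw [QuotientGroup.leftRel_apply] at hab
    have : b⁻¹ = (a⁻¹ * b)⁻¹ * a⁻¹ := by group
    change msymQ n a⁻¹ q = msymQ n b⁻¹ q
    rw [this, msymQ_mul_of_mem n (Subgroup.inv_mem _ hab)]

/-- `[gΓ₁(N), q] = [g⁻¹, q]`. [folklore] -/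
@[simp] theorem cosetSym_mk (g : SL(2, ℤ)) (q : Fin 2 → ℤ) :
    cosetSym N n (g : Coset (Gamma1 N)) q = msymQ n g⁻¹ q := rfl

variable {N n} in
/-- Functions `ℤ² → E` that are polynomial of degree `n` in the sense of `PolySymbol.poly`. [folklore] -/
def IsPolyE {E : Type*} [AddCommGroup E] [Module ℚ E] (n : ℕ) (F : (Fin 2 → ℤ) → E) : Prop :=
  ∃ μ : ℕ → E, ∀ q, F q = ∑ j ∈ Finset.range (n + 1), mono n j q • μ j

section IsPolyE

variable {N n}
variable {E : Type*} [AddCommGroup E] [Module ℚ E]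

/-- Differences of polynomial functions are polynomial. [folklore] -/
theorem IsPolyE.sub {F G : (Fin 2 → ℤ) → E} (hF : IsPolyE n F) (hG : IsPolyE n G) :
    IsPolyE n (fun q ↦ F q - G q) := by
  obtain ⟨μ, hμ⟩ := hF
  obtain ⟨ν, hν⟩ := hG
  refine ⟨fun j ↦ μ j - ν j, fun q ↦ ?_⟩
  simp only [hμ q, hν q, smul_sub, Finset.sum_sub_distrib]

/-- **Change of monomial expansion**: a combination `∑ᵢ wᵢ(q) eᵢ` with weights `wᵢ ∈ W_n` is a
combination `∑ⱼ q₀ʲq₁ⁿ⁻ʲ μⱼ` of monomials. [folklore] -/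
theorem isPolyE_sum_smul {ι : Type*} (s : Finset ι) (w : ι → (Fin 2 → ℤ) → ℚ)
    (hw : ∀ i ∈ s, w i ∈ polyFun n) (e : ι → E) :
    IsPolyE n (fun q ↦ ∑ i ∈ s, w i q • e i) := by
  classical
  set w' : ι → (Fin 2 → ℤ) → ℚ := fun i ↦ if i ∈ s then w i else 0 with hw'def
  have hw' : ∀ i, w' i ∈ polyFun n := fun i ↦ by
    by_cases hi : i ∈ s
    · rw [hw'def]; simp only [hi, if_true]; exact hw i hi
    · rw [hw'def]; simp only [hi, if_false]; exact zero_mem _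
  have hc : ∀ i, ∃ c : Fin (n + 1) → ℚ, ∑ j, c j • mono n (j : ℕ) = w' i := fun i ↦
    (Submodule.mem_span_range_iff_exists_fun ℚ).mp (hw' i)
  choose c hc using hc
  refine ⟨fun j ↦ if h : j < n + 1 then ∑ i ∈ s, c i ⟨j, h⟩ • e i else 0, fun q ↦ ?_⟩
  rw [Finset.sum_range (fun j ↦ mono n j q •
    (if h : j < n + 1 then ∑ i ∈ s, c i ⟨j, h⟩ • e i else 0))]
  simp only [Fin.is_lt, dif_pos, Fin.eta, Finset.smul_sum]
  rw [Finset.sum_comm]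
  refine Finset.sum_congr rfl fun i hi ↦ ?_
  have hwi : w i q = w' i q := by rw [hw'def]; simp [hi]
  rw [hwi, ← hc i, Finset.sum_apply, Finset.sum_smul]
  refine Finset.sum_congr rfl fun j _ ↦ ?_
  rw [Pi.smul_apply, smul_eq_mul, mul_comm, mul_smul]

/-- Polynomial functions are stable under `q ↦ gq`. [folklore] -/
theorem IsPolyE.comp_act {F : (Fin 2 → ℤ) → E} (hF : IsPolyE n F) (g : SL(2, ℤ)) :
    IsPolyE n (fun q ↦ F (act g q)) := by
  obtain ⟨μ, hμ⟩ := hF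
  have := isPolyE_sum_smul (n := n) (Finset.range (n + 1)) (fun j ↦ precomp g (mono n j))
    (fun j hj ↦ precomp_mem n g (mono_mem (Nat.lt_succ_iff.mp (Finset.mem_range.mp hj)))) μ
  obtain ⟨ν, hν⟩ := this
  refine ⟨ν, fun q ↦ ?_⟩
  have h := hν q
  simp only [precomp_apply] at h
  show F (act g q) = _
  rw [hμ]
  exact h

end IsPolyE

/-- The weights `(c q₀ + e q₁)ʲ(-(a q₀ + b q₁))ⁿ⁻ʲ` (`j ≤ n`) lie in `W_n`. [folklore] -/
theorem weight_mem (a b c e : ℤ) {j : ℕ} (hj : j ≤ n) :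
    (fun q : Fin 2 → ℤ ↦ (((c * q 0 + e * q 1) ^ j * (-(a * q 0 + b * q 1)) ^ (n - j) : ℤ) : ℚ)) ∈
      polyFun n := by
  have := pow_mul_pow_mem c e (-a) (-b) (i := j) (j := n - j) (d := n) (by omega)
  convert this using 2 with q
  push_cast
  ring

variable {N} in
/-- **The path functionals are polynomial in `q`** (`pathFnl_eq_sum` and `weight_mem`). [folklore] -/
theorem pathFnl_isPolyE (γ : SL(2, ℤ)) : IsPolyE n (fun q ↦ pathFnl (N := N) n γ q) := by
  have h1 := isPolyE_sum_smul (n := n) (Finset.range (n + 1))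
    (fun j q ↦ ((q 1 ^ j * (-(q 0)) ^ (n - j) : ℤ) : ℚ))
    (fun j hj ↦ by
      have hw := weight_mem n 1 0 0 1 (Nat.lt_succ_iff.mp (Finset.mem_range.mp hj))
      have heq : (fun q : Fin 2 → ℤ ↦ ((q 1 ^ j * (-(q 0)) ^ (n - j) : ℤ) : ℚ)) =
          fun q ↦ (((0 * q 0 + 1 * q 1) ^ j * (-(1 * q 0 + 0 * q 1)) ^ (n - j) : ℤ) : ℚ) := by
        funext q
        simp
      rw [heq]
      exact hw)
    (fun j ↦ momentFunctional1 (N := N) n γ 1 j)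
  have h2 := isPolyE_sum_smul (n := n) (Finset.range (n + 1))
    (fun j q ↦ (((act γ q 1) ^ j * (-(act γ q 0)) ^ (n - j) : ℤ) : ℚ))
    (fun j hj ↦ by
      have hw := weight_mem n (γ 0 0) (γ 0 1) (γ 1 0) (γ 1 1)
        (Nat.lt_succ_iff.mp (Finset.mem_range.mp hj))
      have heq : (fun q : Fin 2 → ℤ ↦ (((act γ q 1) ^ j * (-(act γ q 0)) ^ (n - j) : ℤ) : ℚ)) =
          fun q ↦ (((γ 1 0 * q 0 + γ 1 1 * q 1) ^ j * (-(γ 0 0 * q 0 + γ 0 1 * q 1)) ^ (n - j) :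
            ℤ) : ℚ) := by
        funext q
        rw [act_apply_zero, act_apply_one]
      rw [heq]
      exact hw)
    (fun j ↦ momentFunctional1 (N := N) n 1 γ j)
  obtain ⟨μ, hμ⟩ := h1.sub h2
  refine ⟨μ, fun q ↦ ?_⟩
  have h := hμ q
  simp only at h
  show pathFnl n γ q = _
  rw [pathFnl_eq_sum, ← h]
  simp only [Int.cast_smul_eq_zsmul]

variable {N} in
/-- **The Manin symbols are polynomial in `q`.** [folklore] -/
theorem msymQ_isPolyE (h : SL(2, ℤ)) : IsPolyE n (fun q ↦ msymQ (N := N) n h q) :=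
  (pathFnl_isPolyE n h).sub ((pathFnl_isPolyE n (h * S)).comp_act S⁻¹)

/-- **The period Manin symbols of `S_{n+2}(Γ₁(N))` form a system of Manin symbols** (polynomial in
`q`, two-term, three-term and sign relations). [cite: Merel1994, §1.2 Prop. 1] -/
def periodSymbol : PolySymbol n (Gamma1 N) (Module.Dual ℂ (CuspForm (Gamma1 N) (n + 2))) where
  toFun := cosetSym N n
  poly x := by
    induction x using QuotientGroup.induction_on with
    | H g =>
      obtain ⟨μ, hμ⟩ := msymQ_isPolyE (N := N) n g⁻¹
      exact ⟨μ, fun q ↦ by rw [cosetSym_mk]; exact hμ q⟩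
  two_term x q := by
    induction x using QuotientGroup.induction_on with
    | H g =>
      rw [MulAction.Quotient.smul_mk, smul_eq_mul, cosetSym_mk, cosetSym_mk, mul_inv_rev, inv_inv]
      exact msymQ_two_term n g⁻¹ q
  three_term x q := by
    induction x using QuotientGroup.induction_on with
    | H g =>
      have e1 : ((T * S)⁻¹ * g)⁻¹ = g⁻¹ * (T * S) := by group
      have e2 : ((T * S)⁻¹ * ((T * S)⁻¹ * g))⁻¹ = g⁻¹ * (T * S) * (T * S) := by group
      rw [MulAction.Quotient.smul_mk, MulAction.Quotient.smul_mk, smul_eq_mul, smul_eq_mul, cosetSym_mk,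
        cosetSym_mk, cosetSym_mk, e1, e2]
      exact msymQ_three_term n g⁻¹ q
  neg x q := by
    induction x using QuotientGroup.induction_on with
    | H g =>
      rw [MulAction.Quotient.smul_mk, smul_eq_mul, cosetSym_mk, cosetSym_mk, mul_inv_rev, inv_neg,
        inv_one, mul_neg_one]
      exact msymQ_neg n g⁻¹ q

end Symbol

/-! ### Manin's trick: the period lattice lies in the span of the symbols -/

section Manin

variable {N : ℕ} [NeZero N] (n : ℕ)

/-- The `ℚ`-span of the period Manin symbols of `S_{n+2}(Γ₁(N))`. [folklore] -/
abbrev symbolSpan : Submodule ℚ (Module.Dual ℂ (CuspForm (Gamma1 N) (n + 2))) :=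
  Submodule.span ℚ (Set.range fun xq : Coset (Gamma1 N) × (Fin 2 → ℤ) ↦
    (periodSymbol N n).toFun xq.1 xq.2)

/-- Every Manin symbol `[h, q]` lies in the span (it is the symbol of the coset `h⁻¹Γ₁(N)`). [folklore] -/
theorem msymQ_mem_symbolSpan (h : SL(2, ℤ)) (q : Fin 2 → ℤ) : msymQ n h q ∈ symbolSpan (N := N) n :=
  Submodule.subset_span ⟨(((h⁻¹ : SL(2, ℤ)) : Coset (Gamma1 N)), q), by
    show (periodSymbol N n).toFun _ q = _
    rw [show (periodSymbol N n).toFun = cosetSym N n from rfl, cosetSym_mk, inv_inv]⟩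

/-- **Manin's trick in weight `k`** (continued fractions, as a Euclidean induction on the lower-left
entry, carrying `q` along): every path functional `λ_{k,q}`, `k ∈ SL(2, ℤ)`, is a sum of Manin
symbols. Step: `m = -⌊k₁₁/k₁₀⌋`, `k' = kTᵐS`, `p = T⁻ᵐq`; then
`λ_{k,q} = λ_{kTᵐ,p} = [kTᵐ, p] + λ_{k',S⁻¹p}` with `|k'₁₀| < |k₁₀|`; and `λ_{k,q} = λ_{1,kq} = 0`
when `k₁₀ = 0` (Manin 1972, Thm. 1.6; Merel 1994, Prop. 1: "the elements `{g0, g∞}` generate").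
[cite: Merel1994, §1.2 Prop. 1] -/
theorem pathFnl_mem_symbolSpan (k : SL(2, ℤ)) (q : Fin 2 → ℤ) :
    pathFnl n k q ∈ symbolSpan (N := N) n := by
  suffices H : ∀ m : ℕ, ∀ (k : SL(2, ℤ)) (q : Fin 2 → ℤ), (k 1 0).natAbs = m →
      pathFnl n k q ∈ symbolSpan (N := N) n from H _ k q rfl
  intro m
  induction m using Nat.strong_induction_on with
  | _ m ih =>
    intro k q hk
    by_cases hz : k 1 0 = 0
    · rw [← one_mul k, pathFnl_mul_of_apply_one_zero n 1 k hz, pathFnl_one]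
      exact zero_mem _
    · set m' : ℤ := -(k 1 1 / k 1 0) with hm'
      set k' : SL(2, ℤ) := k * T ^ m' * S with hk'
      have hk'10 : k' 1 0 = k 1 1 % k 1 0 := by
        simp only [hk', coe_mul, ModularGroup.coe_S, ModularGroup.coe_T_zpow, Matrix.mul_apply,
          Fin.sum_univ_two]
        simp [hm', Int.emod_def]
        ring
      have hlt : (k' 1 0).natAbs < m := by
        rw [← hk, hk'10]
        have h0 := Int.emod_nonneg (k 1 1) hz
        have h1 := Int.emod_lt_abs (k 1 1) hz
        zify
        rw [abs_of_nonneg h0]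
        exact h1
      set p : Fin 2 → ℤ := act (T ^ m')⁻¹ q with hp
      have hdecomp : pathFnl (N := N) n k q = msymQ n (k * T ^ m') p + pathFnl n k' (act S⁻¹ p) := by
        rw [msymQ_def, hk', sub_add_cancel, pathFnl_mul_T_zpow, hp, act_act_inv]
      rw [hdecomp]
      exact add_mem (msymQ_mem_symbolSpan n _ _) (ih _ hlt k' _ rfl)

variable (N) in
/-- **The Eichler–Shimura period lattice of `S_{n+2}(Γ₁(N))` lies in the `ℚ`-span of the period
Manin symbols** (its generators `λ_{σ,q}`, `σ ∈ Γ₀(N)`, are path functionals). [folklore] -/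
theorem periodLatticeK1_subset_symbolSpan :
    (periodLatticeK1 (N := N) n : Set (Module.Dual ℂ (CuspForm (Gamma1 N) (n + 2)))) ⊆
      symbolSpan (N := N) n := by
  change periodLatticeK1 n ≤ (symbolSpan (N := N) n).toAddSubgroup
  rw [periodLatticeK1, AddSubgroup.closure_le]
  rintro _ ⟨⟨σ, q⟩, rfl⟩
  exact pathFnl_mem_symbolSpan n (σ : SL(2, ℤ)) q

/-- The symbol span is finite-dimensional (it lies in the image of the formal Manin module). [folklore] -/
instance finite_symbolSpan : Module.Finite ℚ (symbolSpan (N := N) n) := by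
  classical
  set L := (relK n (Gamma1 N)).liftQ (periodSymbol N n).total (periodSymbol N n).relK_le_ker
  have hle : symbolSpan (N := N) n ≤ LinearMap.range L := by
    rw [Submodule.span_le]
    rintro _ ⟨⟨x, q⟩, rfl⟩
    exact ⟨Submodule.Quotient.mk (Pi.single x (ev n q)), by
      rw [Submodule.liftQ_apply, PolySymbol.total_single]⟩
  exact Submodule.finiteDimensional_of_le hle

variable (N) in
/-- The `ℚ`-span of the period lattice is finite-dimensional. [folklore] -/
instance finite_span_periodLatticeK1 :
    Module.Finite ℚ (Submodule.span ℚ (periodLatticeK1 (N := N) n :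
      Set (Module.Dual ℂ (CuspForm (Gamma1 N) (n + 2))))) :=
  Submodule.finiteDimensional_of_le (Submodule.span_le.mpr (periodLatticeK1_subset_symbolSpan N n))

end Manin

/-! ### `Γ₁(N)`, `N ≥ 4`, has no `-1` and no elliptic elements -/

section Free

variable {N : ℕ}

/-- The trace of an element of `Γ₁(N)` is `2 mod N`. [folklore] -/
theorem trace_eq_two_of_mem_gamma1 {γ : SL(2, ℤ)} (hγ : γ ∈ Gamma1 N) :
    ((γ 0 0 : ℤ) : ZMod N) + ((γ 1 1 : ℤ) : ZMod N) = 2 := by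
  obtain ⟨h1, h2, -⟩ := (Gamma1_mem N γ).mp hγ
  rw [h1, h2]
  norm_num

/-- The trace is a class function. [folklore] -/
theorem trace_conj (g h : SL(2, ℤ)) : (h⁻¹ * g * h) 0 0 + (h⁻¹ * g * h) 1 1 = g 0 0 + g 1 1 := by
  have := Matrix.trace_mul_cycle ((h⁻¹ : SL(2, ℤ)) : Matrix (Fin 2) (Fin 2) ℤ)
    (g : Matrix (Fin 2) (Fin 2) ℤ) (h : Matrix (Fin 2) (Fin 2) ℤ)
  rw [← coe_mul, ← coe_mul, ← coe_mul, mul_inv_cancel, Matrix.SpecialLinearGroup.coe_one, one_mul,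
    Matrix.trace_fin_two, Matrix.trace_fin_two] at this
  exact this

/-- An element of `SL(2, ℤ)` whose trace is not `2 mod N` fixes no coset of `Γ₁(N)` (its conjugates
miss `Γ₁(N)`). [folklore] -/
theorem smul_ne_of_trace_ne {g : SL(2, ℤ)} (hg : ((g 0 0 : ℤ) : ZMod N) + ((g 1 1 : ℤ) : ZMod N) ≠ 2)
    (x : Coset (Gamma1 N)) : g • x ≠ x := by
  induction x using QuotientGroup.induction_on with
  | H h =>
    rw [MulAction.Quotient.smul_mk, smul_eq_mul, Ne, QuotientGroup.eq]
    intro hmem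
    have hmem' : h⁻¹ * g * h ∈ Gamma1 N := by
      have : ((g * h)⁻¹ * h)⁻¹ = h⁻¹ * g * h := by group
      rw [← this]
      exact Subgroup.inv_mem _ hmem
    apply hg
    have h2 := trace_eq_two_of_mem_gamma1 hmem'
    have hc := congrArg (Int.cast : ℤ → ZMod N) (trace_conj g h)
    push_cast at hc
    rwa [hc] at h2

/-- **`Γ₁(N)` for `N ≥ 4` contains no conjugate of `-1`, `±S`, `±TS`, `±(TS)²`** (traces `0, ±1`
are not `2 mod N`, and `-1 ≢ 1 mod N`): no `-1`, no elliptic points, the hypothesis of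
`ManinK.twelve_mul_finrank_quotient_le`. [folklore] -/
theorem gamma1_free (hN : 4 ≤ N) :
    ∀ g ∈ ({-1, S, -S, T * S, -(T * S), T * S * (T * S), -(T * S * (T * S))} : Set SL(2, ℤ)),
      ∀ x : Coset (Gamma1 N), g • x ≠ x := by
  haveI : NeZero N := ⟨by omega⟩
  have h0 : (0 : ZMod N) ≠ 2 := by
    intro h
    have : ((2 : ℕ) : ZMod N) = 0 := by rw [Nat.cast_ofNat, ← h]
    rw [CharP.cast_eq_zero_iff (ZMod N) N] at this
    have := Nat.le_of_dvd two_pos this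
    omega
  have h1 : (1 : ZMod N) ≠ 2 := by
    intro h
    have : ((1 : ℕ) : ZMod N) = 0 := by
      rw [Nat.cast_one]
      have : (2 : ZMod N) - 1 = 0 := by rw [← h, sub_self]
      norm_num at this
      exact this
    rw [CharP.cast_eq_zero_iff (ZMod N) N] at this
    have := Nat.le_of_dvd one_pos this
    omega
  have hm1 : (-1 : ZMod N) ≠ 2 := by
    intro h
    have : ((3 : ℕ) : ZMod N) = 0 := by
      rw [Nat.cast_ofNat]
      have : (2 : ZMod N) - (-1) = 0 := by rw [← h, sub_self]
      norm_num at this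
      exact this
    rw [CharP.cast_eq_zero_iff (ZMod N) N] at this
    have := Nat.le_of_dvd (by norm_num) this
    omega
  intro g hg x
  simp only [Set.mem_insert_iff, Set.mem_singleton_iff] at hg
  rcases hg with rfl | rfl | rfl | rfl | rfl | rfl | rfl
  · -- `-1`
    induction x using QuotientGroup.induction_on with
    | H h =>
      rw [MulAction.Quotient.smul_mk, smul_eq_mul, Ne, QuotientGroup.eq]
      intro hmem
      have : (-1 * h)⁻¹ * h = -1 := by rw [neg_one_mul, inv_neg, neg_mul, inv_mul_cancel]
      rw [this, Gamma1_mem] at hmem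
      apply h0
      have := hmem.1
      simp only [Matrix.SpecialLinearGroup.coe_neg, Matrix.SpecialLinearGroup.coe_one,
        Matrix.neg_apply, Matrix.one_apply_eq, Int.cast_neg, Int.cast_one] at this
      have h2 : (2 : ZMod N) = 1 - (-1) := by norm_num
      rw [h2, this, sub_self]
  · exact smul_ne_of_trace_ne (by rw [show (S 0 0 : ℤ) = 0 by decide, show (S 1 1 : ℤ) = 0 by decide]; simpa using h0) x
  · exact smul_ne_of_trace_ne (by rw [show ((-S) 0 0 : ℤ) = 0 by decide, show ((-S) 1 1 : ℤ) = 0 by decide]; simpa using h0) x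
  · exact smul_ne_of_trace_ne (by rw [show ((T * S) 0 0 : ℤ) = 1 by decide, show ((T * S) 1 1 : ℤ) = 0 by decide]; simpa using h1) x
  · exact smul_ne_of_trace_ne (by rw [show ((-(T * S)) 0 0 : ℤ) = -1 by decide, show ((-(T * S)) 1 1 : ℤ) = 0 by decide]; simpa using hm1) x
  · exact smul_ne_of_trace_ne (by rw [show ((T * S * (T * S)) 0 0 : ℤ) = 0 by decide, show ((T * S * (T * S)) 1 1 : ℤ) = -1 by decide]; simpa using hm1) x
  · exact smul_ne_of_trace_ne (by rw [show ((-(T * S * (T * S))) 0 0 : ℤ) = 0 by decide, show ((-(T * S * (T * S))) 1 1 : ℤ) = 1 by decide]; simpa using h1) x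

end Free

/-! ### The rank bound -/

section RankBound

variable (N : ℕ) [NeZero N] (n : ℕ)

/-- **`12 dim_ℚ ℚ[x, q] ≤ (n + 1)[SL(2, ℤ) : Γ₁(N)]`** for the period Manin symbols, `n ≥ 1`, `N ≥ 4`.
[cite: Merel1994, §1.3 Prop. 3] -/
theorem twelve_mul_finrank_symbolSpan_le (hn : 1 ≤ n) (hN : 4 ≤ N) :
    12 * finrank ℚ (symbolSpan (N := N) n) ≤ (n + 1) * (Gamma1 N).index :=
  (periodSymbol N n).twelve_mul_finrank_span_le n (Gamma1 N) hn (gamma1_free hN)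

/-- **Rank bound for the Eichler–Shimura period lattice of `S_{n+2}(Γ₁(N))`, first form**:
`12 dim_ℚ ℚΛ ≤ (n + 1)[SL(2, ℤ) : Γ₁(N)]` (`n ≥ 1`, `N ≥ 4`). Since `Λ` is finitely generated
(`periodLatticeK1_fg`), `rank_ℤ Λ = dim_ℚ ℚΛ`. The sharp bound subtracts the cusps (boundary symbols
and a Manin–Drinfeld step; sequel). [cite: Merel1994, §1.3 Prop. 3] -/
theorem twelve_mul_finrank_span_periodLatticeK1_le (hn : 1 ≤ n) (hN : 4 ≤ N) :
    12 * finrank ℚ (Submodule.span ℚ (periodLatticeK1 (N := N) n :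
      Set (Module.Dual ℂ (CuspForm (Gamma1 N) (n + 2))))) ≤ (n + 1) * (Gamma1 N).index := by
  have hle : Submodule.span ℚ (periodLatticeK1 (N := N) n :
      Set (Module.Dual ℂ (CuspForm (Gamma1 N) (n + 2)))) ≤ symbolSpan (N := N) n :=
    Submodule.span_le.mpr (periodLatticeK1_subset_symbolSpan N n)
  calc 12 * finrank ℚ (Submodule.span ℚ (periodLatticeK1 (N := N) n :
        Set (Module.Dual ℂ (CuspForm (Gamma1 N) (n + 2)))))
      ≤ 12 * finrank ℚ (symbolSpan (N := N) n) :=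
        Nat.mul_le_mul_left 12 (LinearMap.finrank_le_finrank_of_injective
          (f := Submodule.inclusion hle) (Submodule.inclusion_injective hle))
    _ ≤ (n + 1) * (Gamma1 N).index := twelve_mul_finrank_symbolSpan_le N n hn hN

/-- **Generator form**: if `(n + 1)[SL(2, ℤ) : Γ₁(N)] ≤ 12 m` (`n ≥ 1`, `N ≥ 4`) then the period
lattice of `S_{n+2}(Γ₁(N))` is the `ℤ`-span of `m` functionals
(`exists_coe_eq_span_range_of_finrank_span_le`). [folklore] -/
theorem periodLatticeK1_eq_span_of_le (hn : 1 ≤ n) (hN : 4 ≤ N) {m : ℕ}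
    (hm : (n + 1) * (Gamma1 N).index ≤ 12 * m) :
    ∃ g : Fin m → Module.Dual ℂ (CuspForm (Gamma1 N) (n + 2)),
      (periodLatticeK1 (N := N) n : Set (Module.Dual ℂ (CuspForm (Gamma1 N) (n + 2)))) =
        Submodule.span ℤ (Set.range g) :=
  exists_coe_eq_span_range_of_finrank_span_le (periodLatticeK1 n) (periodLatticeK1_fg N n)
    (Nat.le_of_mul_le_mul_left ((twelve_mul_finrank_span_periodLatticeK1_le N n hn hN).trans hm)
      (by norm_num : 0 < 12))

end RankBound

end ManinK

end Literature.NumberTheory.EllipticCurves.ModularForms
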